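import Summits.Ventures.Crystal3D.StickySpheres.ElevenVertexCones
import Summits.Ventures.Crystal3D.StickySpheres.RadiusOne
import HarnessLib

/-!
# The listed maximisers are realisable: `HC29` and the first `L(10,25)` graph are contact graphs of integer models

Venture `Crystal3D` (cell `pub-crystal3d`, seat p3). The complete-list HYPOTHESES of the cone certificates say "every
relaxed-realisable graph of the stratum is one of the listed graphs". This file proves the cheap converse for the three
lists that consist of maximisers: the listed graphs ARE relaxed-realisable, as the contact graphs of the tree's integer
witnesses (`Witnesses.twinOcta12Int`: two regular octahedra of edge `√18` sharing a face, plus tetrahedral caps; Bezdek 2013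
§2.1), relabelled:

* `relaxedRealisable_HC29` — `HC29` (the unique 29-contact graph on 11 vertices) is realised by the twin octahedra + 2 caps;
* `relaxedRealisable_L25_first` — the first graph of `L(10,25)` by the twin octahedra + 1 cap
  (`HC33` by the twin octahedra + 3 caps is in `ThirteenVertexCones.lean`).

So, e.g., `CompleteListHypothesis 4 29 11 {HC29}` is SHARP: together with `relaxedRealisable_HC29` it says that the
relaxed-realisable 11-vertex graphs with 29 edges and minimum degree `≥ 4` are exactly the graphs isomorphic to `HC29`.
General tool: `relaxedRealisable_boolGraph_of_intConfig` (an integer model whose squared distances are `= m` on the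
table's edges and `≥ m` on all pairs realises the table graph at scale `1/√m`). HONEST FRAMING: kernel arithmetic
(`decide`), standard axioms; nothing here is a completeness statement.
-/

noncomputable section

namespace Summit.Ventures.Crystal3D

open Literature.Geometry.DiscreteGeometry (sqNormInt)
open Literature.Barriers.AtomisticToContinuum (intConfig)

/-- **Integer models realise table graphs (relaxed semantics):** if `|c i − c j|² = m` on every edge of the table and
`|c i − c j|² ≥ m` for all `i ≠ j`, then `i ↦ c i / √m` relaxed-realises `boolGraph adj`. [folklore] -/
theorem relaxedRealisable_boolGraph_of_intConfig {N : ℕ} (adj : Fin N → Fin N → Bool) (hs : ∀ a b, adj a b = adj b a)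
    (hl : ∀ a, adj a a = false) (c : Fin N → Fin 3 → ℤ) {m : ℕ} (hm : 0 < m)
    (hedge : ∀ i j, adj i j = true → sqNormInt (c i - c j) = m)
    (hsep : ∀ i j, i ≠ j → (m : ℤ) ≤ sqNormInt (c i - c j)) :
    RelaxedRealisable (boolGraph adj hs hl) := by
  refine ⟨intConfig c (1 / Real.sqrt m), fun i j hij => ?_,
    fun i j hij => (isUnitPacking_intConfig c hm hsep).one_le_dist hij⟩
  rw [dist_intConfig_inv_sqrt c hm, hedge i j hij, Int.cast_natCast]
  have hmR : (m : ℝ) ≠ 0 := by exact_mod_cast hm.ne'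
  rw [div_self hmR, Real.sqrt_one]

/-- Integer model of `HC29` (vertex order of `HC29Data.rows`): twin octahedra `(±3,0,0),(0,±3,0),(0,0,±3)` ∪
`(1,4,4),(4,1,4),(4,4,1)` with the caps `(3,3,-3)`, `(-3,3,3)`; contact at squared distance `18`. [folklore] -/
def hc29Int : Fin 11 → Fin 3 → ℤ :=
  ![![3, 3, -3], ![-3, 3, 3], ![0, -3, 0], ![4, 1, 4], ![0, 0, -3], ![-3, 0, 0], ![1, 4, 4], ![4, 4, 1], ![3, 0, 0],
    ![0, 0, 3], ![0, 3, 0]]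

/-- **`HC29` is relaxed-realisable** (indeed it is the contact graph of the 11-ball twin-octahedra-with-two-caps packing,
`29` contacts). [folklore] -/
theorem relaxedRealisable_HC29 : RelaxedRealisable HC29 :=
  relaxedRealisable_boolGraph_of_intConfig HC29Data.adj HC29Data.adj_symm HC29Data.adj_irrefl hc29Int (m := 18)
    (by norm_num) (by decide +kernel) (by decide +kernel)

/-- Integer model of the first graph of `L(10,25)` (`I@`uTrfVw`, vertex order of `L25rows[0]`): the twin octahedra with one
cap. [folklore] -/
def l25firstInt : Fin 10 → Fin 3 → ℤ :=
  ![![4, 1, 4], ![3, 3, -3], ![0, -3, 0], ![-3, 0, 0], ![1, 4, 4], ![0, 0, -3], ![4, 4, 1], ![0, 0, 3], ![3, 0, 0],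
    ![0, 3, 0]]

/-- **The first `L(10,25)` graph is relaxed-realisable** (`25` contacts on 10 balls). [folklore] -/
theorem relaxedRealisable_L25_first : RelaxedRealisable (tableGraph 10 (L25rows.getD 0 [])) := by
  rw [tableGraph_eq (by decide +kernel) (by decide +kernel)]
  exact relaxedRealisable_boolGraph_of_intConfig _ _ _ l25firstInt (m := 18) (by norm_num) (by decide +kernel)
    (by decide +kernel)

/-- **`S_11(29) = {HC29}` is sharp:** under the complete-list hypothesis, a graph on `11` vertices with `29` edges and minimum
degree `≥ 4` is relaxed-realisable IFF it is isomorphic to `HC29`. [folklore] -/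
theorem relaxedRealisable_iff_iso_HC29 (hL : CompleteListHypothesis 4 29 11 {HC29}) (G : SimpleGraph (Fin 11))
    [DecidableRel G.Adj] (he : G.edgeFinset.card = 29) (hd : ∀ i, 4 ≤ G.degree i) :
    RelaxedRealisable G ↔ Nonempty (G ≃g HC29) := by
  constructor
  · intro hG
    obtain ⟨H, hH, hiso⟩ := hL G he hd hG
    rw [Set.mem_singleton_iff] at hH
    subst hH
    exact hiso
  · rintro ⟨φ⟩
    exact relaxedRealisable_HC29.of_iso φ.symm

end Summit.Ventures.Crystal3D

end
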